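import Mathlib.Analysis.SpecialFunctions.Pow.Deriv
import Mathlib.Analysis.SpecialFunctions.Pow.Continuity
import Mathlib.Analysis.SpecialFunctions.Complex.Log
import Literature.Analysis.Complex.SchwarzReflection
import HarnessLib

/-!
# Pick engine helper (line `pick-half-plane`, stub `stub_pickEngine`): the two-arm reflection

Support file for crux `BoundaryClosureR` (stmt-CriticalPhenomena-14004), line `pick-half-plane`,
stub `stub_pickEngine`, STAGE 2 at the root.  In the limit the normalised developing map `h` is
holomorphic on the upper half-disc `U = {im z > im x} ∩ B(x, r)` at a pinned flat root `x`,
continuous up to the two open boundary rays, and maps the EAST ray into the line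
`p + e^{iθ}ℝ` and the WEST ray into the line `p + e^{i(θ - π/4)}ℝ` (the two straight arms of
`DevelopingMapExact` (E4): windings `-π` / `+π`, phase factor `e^{i(3/8)·2π} = e^{3πi/4} ≡ e^{-iπ/4}`
as a line direction).  Multiplying by the principal branch `(z - x)^{1/4}` makes BOTH boundary
lines real (`(-t)^{1/4} = t^{1/4} e^{iπ/4}` absorbs the angle `π/4` between the arms), so ONE
Schwarz reflection across the real axis (the tree's `Complex.differentiableOn_schwarzReflection`,
Conway IX.1.1) continues `G = e^{-iθ} (h - p) (z - x)^{1/4}` to a holomorphic function on the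
punctured disc `B(x, r) ∖ {x}`; and `h - p = e^{iθ} (z - x)^{-1/4} G` on `U`.  This is the input
`G` of the root-order helper (`…PickEngineRootOrder`): the exact order `5/4` of the limit density
then follows once `G` is known to be meromorphic at `x`.

* `continuousWithinAt_cpow_const_of_im_nonneg` — the principal branch `w ↦ w ^ b` is continuous
  within the closed upper half-plane at every `w ≠ 0` (also on the negative axis);
* `pickEngine_twoArmReflection` — the statement above (registered sub-goal of `stub_pickEngine`).

References: Conway, *Functions of One Complex Variable I* (1978), IX.1.1; Ahlfors (1979) Ch. 4
§6.5 (reflection principle).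
-/

noncomputable section

open scoped Topology ComplexConjugate
open Filter Set Metric Complex

namespace Summit.CriticalPhenomena.SAWScalingLimit.Theorems.PickHalfPlane.Engine

/-- The principal branch `w ↦ w ^ b` is continuous WITHIN the closed upper half-plane
`{im ≥ 0}` at every `w ≠ 0`: at points of the slit plane it is continuous outright, and at a
point of the negative real axis its restriction to `{im ≥ 0}` is continuous because the
principal logarithm is (`Complex.continuousWithinAt_log_of_re_neg_of_im_zero`). [folklore] -/
theorem continuousWithinAt_cpow_const_of_im_nonneg {w : ℂ} (hw : w ≠ 0) (b : ℂ) :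
    ContinuousWithinAt (fun z : ℂ => z ^ b) {z : ℂ | 0 ≤ z.im} w := by
  by_cases hslit : w ∈ slitPlane
  · exact (continuousAt_cpow_const hslit).continuousWithinAt
  · -- `w` lies on the negative real axis
    rw [mem_slitPlane_iff, not_or, not_lt, not_ne_iff] at hslit
    obtain ⟨hre, him⟩ := hslit
    have hre' : w.re < 0 := by
      rcases hre.lt_or_eq with h | h
      · exact h
      · exact absurd (Complex.ext h him) hw
    have hlog := continuousWithinAt_log_of_re_neg_of_im_zero hre' him
    have hexp : ContinuousWithinAt (fun z : ℂ => exp (log z * b)) {z : ℂ | 0 ≤ z.im} w :=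
      continuous_exp.continuousAt.comp_continuousWithinAt (hlog.mul continuousWithinAt_const)
    refine hexp.congr_of_eventuallyEq ?_ (cpow_def_of_ne_zero hw b)
    have hne : ∀ᶠ z in 𝓝[{z : ℂ | 0 ≤ z.im}] w, z ≠ 0 :=
      mem_nhdsWithin_of_mem_nhds (isOpen_ne.mem_nhds hw)
    filter_upwards [hne] with z hz
    exact cpow_def_of_ne_zero hz b

/-- **Two-arm reflection at a pinned flat root (registered sub-goal `pickEngine_twoArmReflection`
of stub `stub_pickEngine`).** Let `h` be holomorphic on the upper half-disc
`U = {im z > im x} ∩ B(x, r)`, continuous on the closed upper half-disc punctured at `x`, with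
`h(z) ∈ p + e^{iθ}ℝ` on the east ray and `h(z) ∈ p + e^{i(θ-π/4)}ℝ` on the west ray. Then there
is `G` holomorphic on the punctured disc `B(x, r) ∖ {x}` with
`G = e^{-iθ} (h - p) (z - x)^{1/4}` on the punctured closed upper half-disc and
`h - p = e^{iθ} (z - x)^{-1/4} G` on `U` (principal branches). Proof: both boundary lines of
`G` are the real axis, so the Schwarz reflection principle across `im z = im x` applies
(Conway 1978, IX.1.1, in the tree as `Complex.differentiableOn_schwarzReflection`). [folklore] -/
theorem pickEngine_twoArmReflection :
    ∀ (x p : ℂ) (θ r : ℝ) (h : ℂ → ℂ), 0 < r →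
      DifferentiableOn ℂ h ({z : ℂ | x.im < z.im} ∩ Metric.ball x r) →
      ContinuousOn h (({z : ℂ | x.im ≤ z.im} ∩ Metric.ball x r) \ {x}) →
      (∀ z ∈ Metric.ball x r, z.im = x.im → x.re < z.re →
        ∃ s : ℝ, h z = p + Complex.exp ((θ : ℂ) * Complex.I) * s) →
      (∀ z ∈ Metric.ball x r, z.im = x.im → z.re < x.re →
        ∃ s : ℝ, h z = p + Complex.exp (((θ - Real.pi / 4 : ℝ) : ℂ) * Complex.I) * s) →
      ∃ G : ℂ → ℂ, DifferentiableOn ℂ G (Metric.ball x r \ {x}) ∧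
        (∀ z ∈ ({z : ℂ | x.im ≤ z.im} ∩ Metric.ball x r) \ {x},
          G z = Complex.exp (-((θ : ℂ) * Complex.I)) * (h z - p) * (z - x) ^ ((1 / 4 : ℂ))) ∧
        (∀ z ∈ {z : ℂ | x.im < z.im} ∩ Metric.ball x r,
          h z - p = Complex.exp ((θ : ℂ) * Complex.I) * ((z - x) ^ (-(1 / 4 : ℂ)) * G z)) := by
  intro x p θ r h hr hdiff hcont heast hwest
  -- the translated, rotated and straightened function
  set F : ℂ → ℂ := fun w => exp (-((θ : ℂ) * I)) * (h (w + x) - p) * w ^ ((1 / 4 : ℂ)) with hF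
  set U₀ : Set ℂ := ball (0 : ℂ) r \ {0} with hU₀
  have hU₀open : IsOpen U₀ := isOpen_ball.sdiff isClosed_singleton
  have hU₀symm : ∀ w ∈ U₀, conj w ∈ U₀ := by
    rintro w ⟨hw, hw0⟩
    refine ⟨by simpa [mem_ball, dist_eq_norm] using hw, ?_⟩
    simpa using hw0
  -- translation bookkeeping
  have hshift_mem : ∀ {w : ℂ}, w ∈ U₀ → 0 ≤ w.im →
      w + x ∈ ({z : ℂ | x.im ≤ z.im} ∩ ball x r) \ {x} := by
    rintro w ⟨hw, hw0⟩ hwim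
    refine ⟨⟨?_, ?_⟩, ?_⟩
    · show x.im ≤ (w + x).im
      simp [hwim]
    · simpa [mem_ball, dist_eq_norm] using hw
    · simpa using hw0
  have hshift_mem' : ∀ {w : ℂ}, w ∈ ball (0 : ℂ) r → 0 < w.im →
      w + x ∈ {z : ℂ | x.im < z.im} ∩ ball x r := by
    rintro w hw hwim
    refine ⟨?_, ?_⟩
    · show x.im < (w + x).im
      simp [hwim]
    · simpa [mem_ball, dist_eq_norm] using hw
  -- (1) continuity on the punctured closed upper half-disc
  have hFc : ContinuousOn F (U₀ ∩ {w | 0 ≤ w.im}) := by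
    rintro w ⟨hwU, hwim⟩
    have hw0 : w ≠ 0 := hwU.2
    have h1 : ContinuousWithinAt (fun w => h (w + x)) (U₀ ∩ {w | 0 ≤ w.im}) w := by
      have hsh : ContinuousWithinAt (fun w : ℂ => w + x) (U₀ ∩ {w | 0 ≤ w.im}) w :=
        (continuous_id.add continuous_const).continuousWithinAt
      refine ContinuousWithinAt.comp (hcont (w + x) (hshift_mem hwU hwim)) hsh ?_
      rintro w' ⟨hw'U, hw'im⟩
      exact hshift_mem hw'U hw'im
    have h2 : ContinuousWithinAt (fun w : ℂ => w ^ ((1 / 4 : ℂ))) (U₀ ∩ {w | 0 ≤ w.im}) w :=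
      (continuousWithinAt_cpow_const_of_im_nonneg hw0 _).mono inter_subset_right
    exact ((continuousWithinAt_const.mul (h1.sub continuousWithinAt_const)).mul h2)
  -- (2) holomorphy on the open upper half-disc
  have hFd : DifferentiableOn ℂ F (U₀ ∩ {w | 0 < w.im}) := by
    rintro w ⟨hwU, hwim⟩
    have hwim' : 0 < w.im := hwim
    have hslit : w ∈ slitPlane := mem_slitPlane_iff.2 (Or.inr hwim'.ne')
    have h1 : DifferentiableWithinAt ℂ (fun w => h (w + x)) (U₀ ∩ {w | 0 < w.im}) w := by
      have hd : DifferentiableAt ℂ h (w + x) := by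
        refine (hdiff (w + x) (hshift_mem' hwU.1 hwim')).differentiableAt ?_
        exact ((isOpen_lt continuous_const continuous_im).inter isOpen_ball).mem_nhds
          (hshift_mem' hwU.1 hwim')
      exact (hd.comp w (differentiableAt_id.add (differentiableAt_const x))).differentiableWithinAt
    have h2 : DifferentiableWithinAt ℂ (fun w : ℂ => w ^ ((1 / 4 : ℂ))) (U₀ ∩ {w | 0 < w.im}) w :=
      (Complex.hasStrictDerivAt_cpow_const hslit).hasDerivAt.differentiableAt.differentiableWithinAt
    exact ((differentiableWithinAt_const _).mul (h1.sub (differentiableWithinAt_const _))).mul h2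
  -- (3) real boundary values on both rays
  have hFreal : ∀ w ∈ U₀, w.im = 0 → conj (F w) = F w := by
    rintro w ⟨hw, hw0⟩ hwim
    have hw0' : w ≠ 0 := hw0
    have hwre : w.re ≠ 0 := fun h0 => hw0' (Complex.ext h0 hwim)
    have hw_eq : w = (w.re : ℂ) := Complex.ext (by simp) (by simp [hwim])
    have hmem : w + x ∈ ball x r := by simpa [mem_ball, dist_eq_norm] using hw
    have him : (w + x).im = x.im := by simp [hwim]
    rcases lt_or_gt_of_ne hwre with hneg | hpos
    · -- west ray: `h - p = e^{i(θ - π/4)} s`, `w^{1/4} = |w|^{1/4} e^{iπ/4}`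
      have hre : (w + x).re < x.re := by simp [hneg]
      obtain ⟨s, hs⟩ := hwest (w + x) hmem him hre
      have hpow : w ^ ((1 / 4 : ℂ)) = ((((-w.re) ^ (1 / 4 : ℝ) : ℝ)) : ℂ) *
          exp (Real.pi * I * (1 / 4 : ℂ)) := by
        rw [hw_eq, Complex.ofReal_re, ofReal_cpow_of_nonpos hneg.le, ← Complex.ofReal_neg,
          show ((1 / 4 : ℂ)) = ((1 / 4 : ℝ) : ℂ) by push_cast; ring, ← ofReal_cpow (by linarith)]
      have hval : F w = (((s * (-w.re) ^ (1 / 4 : ℝ) : ℝ)) : ℂ) := by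
        simp only [hF]
        rw [hs, add_sub_cancel_left, hpow]
        have : exp (-((θ : ℂ) * I)) * exp (((θ - Real.pi / 4 : ℝ) : ℂ) * I) *
            exp (Real.pi * I * (1 / 4 : ℂ)) = 1 := by
          rw [← Complex.exp_add, ← Complex.exp_add,
            show -((θ : ℂ) * I) + ((θ - Real.pi / 4 : ℝ) : ℂ) * I + Real.pi * I * (1 / 4 : ℂ) = 0 by
              push_cast; ring, Complex.exp_zero]
        calc exp (-((θ : ℂ) * I)) * (exp (((θ - Real.pi / 4 : ℝ) : ℂ) * I) * (s : ℂ)) *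
              ((((-w.re) ^ (1 / 4 : ℝ) : ℝ) : ℂ) * exp (Real.pi * I * (1 / 4 : ℂ)))
            = (exp (-((θ : ℂ) * I)) * exp (((θ - Real.pi / 4 : ℝ) : ℂ) * I) *
                exp (Real.pi * I * (1 / 4 : ℂ))) * ((s : ℂ) * (((-w.re) ^ (1 / 4 : ℝ) : ℝ) : ℂ)) := by
              ring
          _ = _ := by rw [this]; push_cast; ring
      rw [hval, Complex.conj_ofReal]
    · -- east ray: `h - p = e^{iθ} s`, `w^{1/4}` real
      have hre : x.re < (w + x).re := by simp [hpos]
      obtain ⟨s, hs⟩ := heast (w + x) hmem him hre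
      have hpow : w ^ ((1 / 4 : ℂ)) = (((w.re ^ (1 / 4 : ℝ) : ℝ)) : ℂ) := by
        rw [hw_eq, Complex.ofReal_re, show ((1 / 4 : ℂ)) = ((1 / 4 : ℝ) : ℂ) by push_cast; ring,
          ← ofReal_cpow hpos.le]
      have hval : F w = (((s * w.re ^ (1 / 4 : ℝ) : ℝ)) : ℂ) := by
        simp only [hF]
        rw [hs, add_sub_cancel_left, hpow]
        have : exp (-((θ : ℂ) * I)) * exp ((θ : ℂ) * I) = 1 := by
          rw [← Complex.exp_add, show -((θ : ℂ) * I) + (θ : ℂ) * I = 0 by ring, Complex.exp_zero]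
        calc exp (-((θ : ℂ) * I)) * (exp ((θ : ℂ) * I) * (s : ℂ)) * (((w.re ^ (1 / 4 : ℝ) : ℝ)) : ℂ)
            = (exp (-((θ : ℂ) * I)) * exp ((θ : ℂ) * I)) * ((s : ℂ) * (((w.re ^ (1 / 4 : ℝ) : ℝ)) : ℂ)) := by
              ring
          _ = _ := by rw [this]; push_cast; ring
      rw [hval, Complex.conj_ofReal]
  -- (4) reflect and translate back
  have hG₀ := Complex.differentiableOn_schwarzReflection hU₀open hU₀symm hFc hFd hFreal
  refine ⟨fun z => schwarzReflection F (z - x), ?_, ?_, ?_⟩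
  · refine hG₀.comp (differentiableOn_id.sub (differentiableOn_const x)) ?_
    rintro z ⟨hz, hzx⟩
    refine ⟨by simpa [mem_ball, dist_eq_norm] using hz, ?_⟩
    simpa [sub_eq_zero] using hzx
  · rintro z ⟨⟨hzim, hz⟩, hzx⟩
    have hzim' : 0 ≤ (z - x).im := by
      simp only [sub_im, sub_nonneg]; exact hzim
    show schwarzReflection F (z - x) = _
    rw [schwarzReflection_of_nonneg hzim']
    simp [hF]
  · rintro z ⟨hzim, hz⟩
    have hzim' : 0 < (z - x).im := by
      simp only [sub_im, sub_pos]; exact hzim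
    have hzx : z - x ≠ 0 := by
      intro h0; rw [h0] at hzim'; simp at hzim'
    show h z - p = exp ((θ : ℂ) * I) * ((z - x) ^ (-(1 / 4 : ℂ)) * schwarzReflection F (z - x))
    rw [schwarzReflection_of_nonneg hzim'.le]
    simp only [hF, sub_add_cancel]
    have h1 : (z - x) ^ (-(1 / 4 : ℂ)) * (z - x) ^ ((1 / 4 : ℂ)) = 1 := by
      rw [← cpow_add _ _ hzx, show -(1 / 4 : ℂ) + 1 / 4 = 0 by ring, cpow_zero]
    have h2 : exp ((θ : ℂ) * I) * exp (-((θ : ℂ) * I)) = 1 := by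
      rw [← Complex.exp_add, show (θ : ℂ) * I + -((θ : ℂ) * I) = 0 by ring, Complex.exp_zero]
    calc h z - p = (exp ((θ : ℂ) * I) * exp (-((θ : ℂ) * I))) * (h z - p) *
          ((z - x) ^ (-(1 / 4 : ℂ)) * (z - x) ^ ((1 / 4 : ℂ))) := by rw [h1, h2]; ring
      _ = _ := by ring

end Summit.CriticalPhenomena.SAWScalingLimit.Theorems.PickHalfPlane.Engine

end
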